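import Literature.Topology.FourManifolds.CappellShanesonClassNumberOneLarge
import Mathlib.NumberTheory.NumberField.InfinitePlace.TotallyRealComplex
import HarnessLib

/-!
# The Cappell–Shaneson cubic fields are totally real: the sharp Minkowski bound

Serves the named fact
`Literature.Topology.FourManifolds.kimYamada2023_nonempty_diffeomorph_sphere_four_of_trace_mem_Icc`
(`CappellShaneson.lean`; M. H. Kim, S. Yamada, Kyungpook Math. J. 63 (2023) 373–411 =
arXiv:1707.03860, Cor. C) through the per-trace class-group computations behind Theorem B
(`CappellShanesonClassGroup<N>.lean`): for `a ≥ 6` the cubic `f_a = x³ - ax² + (a-1)x - 1` has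
three real roots (sign changes at `0 < 1/2 < 1 < a`), so a cubic field generated by a root of `f_a`
is totally real (`r₂ = 0`) and the Minkowski constant is `M_K = (3!/3³)√d_K = (2/9)√d_K`, without
the factor `4/π` of the general bound `floor_minkowskiBound_le_cubic` (which only uses `r₂ ≤ 1`).
PROVED here:

* `exists_three_roots`, `aeval_csPoly_conj_eq`: every complex root of `f_a` (`a ≥ 6`) is real;
* `isTotallyReal_of_csPoly`, `nrComplexPlaces_eq_zero_of_csPoly`;
* `floor_minkowskiBound_le_cubic_real`: `⌊M_K⌋ ≤ U` as soon as `|d_K| ≤ D ≤ s²` and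
  `(6/27) s < U + 1`, given `r₂ = 0`.

No named fact is introduced (D-0026).

## References

* [KimYamada2023] M. H. Kim, S. Yamada, Kyungpook Math. J. 63 (2023) 373–411 (arXiv:1707.03860),
  §6.1 (proof of Thm. B: class groups of `ℤ[Θₙ]`).
* [Marcus2018] D. A. Marcus, *Number Fields*, 2nd ed., Ch. 5, Cor. 2 of Thm. 37 (Minkowski bound
  `(4/π)^{r₂} (n!/nⁿ) √|d_K|`).
-/

noncomputable section

open Set Polynomial Module NumberField
open scoped NumberField ComplexConjugate

namespace Literature.Topology.FourManifolds

section Roots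

variable {a : ℤ}

/-- A real zero of `f_a` is a complex root of `f_a`. [folklore] -/
theorem aeval_ofReal_of_eval_eq_zero {r : ℝ} (hr : r ^ 3 - a * r ^ 2 + (a - 1) * r - 1 = 0) :
    aeval (r : ℂ) (csPoly a) = 0 := by
  simp only [csPoly, map_sub, map_add, map_mul, map_pow, aeval_X, map_one, eq_intCast, map_intCast]
  have h := congrArg (fun x : ℝ => (x : ℂ)) hr
  push_cast at h ⊢
  linear_combination h

/-- **`f_a` has three real roots for `a ≥ 6`**: one in each of `(0, 1/2)`, `(1/2, 1)`, `(1, a)`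
(`f_a(0) = -1 < 0 < f_a(1/2)`, `f_a(1) = -1 < 0 < f_a(a) = a² - a - 1`). [folklore] -/
theorem exists_three_roots (ha : 6 ≤ a) :
    ∃ r₁ r₂ r₃ : ℝ, r₁ < r₂ ∧ r₂ < r₃ ∧ r₁ ^ 3 - a * r₁ ^ 2 + (a - 1) * r₁ - 1 = 0 ∧
      r₂ ^ 3 - a * r₂ ^ 2 + (a - 1) * r₂ - 1 = 0 ∧ r₃ ^ 3 - a * r₃ ^ 2 + (a - 1) * r₃ - 1 = 0 := by
  set f : ℝ → ℝ := fun x => x ^ 3 - a * x ^ 2 + (a - 1) * x - 1 with hf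
  have ha' : (6 : ℝ) ≤ a := by exact_mod_cast ha
  have h0 : f 0 < 0 := by norm_num [hf]
  have hhalf : 0 < f (1 / 2) := by simp only [hf]; nlinarith
  have h1 : f 1 < 0 := by norm_num [hf]
  have hA : 0 < f a := by simp only [hf]; nlinarith
  have hc : Continuous f := by rw [hf]; fun_prop
  obtain ⟨r₁, hr₁, hr₁0⟩ : ∃ r ∈ Ioo (0 : ℝ) (1 / 2), f r = 0 :=
    intermediate_value_Ioo (by norm_num) hc.continuousOn ⟨h0, hhalf⟩
  obtain ⟨r₂, hr₂, hr₂0⟩ : ∃ r ∈ Ioo (1 / 2 : ℝ) 1, f r = 0 :=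
    intermediate_value_Ioo' (by norm_num) hc.continuousOn ⟨h1, hhalf⟩
  obtain ⟨r₃, hr₃, hr₃0⟩ : ∃ r ∈ Ioo (1 : ℝ) a, f r = 0 :=
    intermediate_value_Ioo (by linarith) hc.continuousOn ⟨h1, hA⟩
  exact ⟨r₁, r₂, r₃, by linarith [hr₁.2, hr₂.1], by linarith [hr₂.2, hr₃.1], hr₁0, hr₂0, hr₃0⟩

/-- **Every complex root of `f_a` is real** (`a ≥ 6`): `f_a` has degree `3` and already three
real roots, so a non-real root and its conjugate would make five. [folklore] -/
theorem aeval_csPoly_conj_eq (ha : 6 ≤ a) {z : ℂ} (hz : aeval z (csPoly a) = 0) : conj z = z := by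
  obtain ⟨r₁, r₂, r₃, h12, h23, hr₁, hr₂, hr₃⟩ := exists_three_roots ha
  by_contra hne
  set p : ℂ[X] := (csPoly a).map (algebraMap ℤ ℂ) with hp
  have hp0 : p ≠ 0 := (monic_csPoly a).map _ |>.ne_zero
  have hdeg : p.natDegree = 3 := by
    rw [hp, (monic_csPoly a).natDegree_map, natDegree_csPoly]
  have hroot : ∀ w : ℂ, aeval w (csPoly a) = 0 → w ∈ p.roots.toFinset := by
    intro w hw
    rw [Multiset.mem_toFinset, mem_roots hp0, IsRoot.def, hp, eval_map, ← aeval_def]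
    exact hw
  have hz1 : z ≠ r₁ := fun h => hne (by rw [h, Complex.conj_ofReal])
  have hz2 : z ≠ r₂ := fun h => hne (by rw [h, Complex.conj_ofReal])
  have hz3 : z ≠ r₃ := fun h => hne (by rw [h, Complex.conj_ofReal])
  have h12' : (r₁ : ℂ) ≠ r₂ := fun h => h12.ne (by exact_mod_cast h)
  have h13' : (r₁ : ℂ) ≠ r₃ := fun h => (h12.trans h23).ne (by exact_mod_cast h)
  have h23' : (r₂ : ℂ) ≠ r₃ := fun h => h23.ne (by exact_mod_cast h)
  set S : Finset ℂ := {z, (r₁ : ℂ), (r₂ : ℂ), (r₃ : ℂ)} with hS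
  have hcard : S.card = 4 := by
    rw [hS, Finset.card_insert_of_notMem, Finset.card_insert_of_notMem,
      Finset.card_insert_of_notMem, Finset.card_singleton]
    · simpa using h23'
    · simp [h12', h13']
    · simp [hz1, hz2, hz3]
  have hsub : S ⊆ p.roots.toFinset := by
    intro w hw
    rw [hS, Finset.mem_insert, Finset.mem_insert, Finset.mem_insert, Finset.mem_singleton] at hw
    rcases hw with rfl | rfl | rfl | rfl
    · exact hroot _ hz
    · exact hroot _ (aeval_ofReal_of_eval_eq_zero hr₁)
    · exact hroot _ (aeval_ofReal_of_eval_eq_zero hr₂)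
    · exact hroot _ (aeval_ofReal_of_eval_eq_zero hr₃)
  have h4 : 4 ≤ p.natDegree :=
    calc 4 = S.card := hcard.symm
      _ ≤ p.roots.toFinset.card := Finset.card_le_card hsub
      _ ≤ Multiset.card p.roots := Multiset.toFinset_card_le _
      _ ≤ p.natDegree := card_roots' p
  omega

end Roots

section Field

variable {K : Type*} [Field K] [NumberField K] {a : ℤ} {θ : K}

/-- **A cubic field generated by a root of `f_a`, `a ≥ 6`, is totally real**: every embedding
`φ : K → ℂ` sends `θ` to a real root and `K = ℚ(θ)`, so `conj ∘ φ = φ`. [folklore] -/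
theorem isTotallyReal_of_csPoly (hθ : aeval θ (csPoly a) = 0) (h3 : finrank ℚ K = 3)
    (ha : 6 ≤ a) : IsTotallyReal K := by
  refine ⟨fun w => InfinitePlace.isReal_iff.mpr ?_⟩
  set φ := w.embedding with hφ
  rw [ComplexEmbedding.isReal_iff]
  have hz : aeval (φ θ) (csPoly a) = 0 := by
    rw [show φ θ = φ.toIntAlgHom θ from rfl, Polynomial.aeval_algHom_apply, hθ, map_zero]
  have hconj : conj (φ θ) = φ θ := aeval_csPoly_conj_eq ha hz
  have key : (ComplexEmbedding.conjugate φ).toRatAlgHom = φ.toRatAlgHom := by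
    refine (csPB hθ h3).algHom_ext ?_
    rw [csPB_gen]
    change (ComplexEmbedding.conjugate φ) θ = φ θ
    rw [ComplexEmbedding.conjugate_coe_eq, hconj]
  exact RingHom.ext fun x => DFunLike.congr_fun key x

/-- Hence `r₂ = 0`: no complex places. [folklore] -/
theorem nrComplexPlaces_eq_zero_of_csPoly (hθ : aeval θ (csPoly a) = 0) (h3 : finrank ℚ K = 3)
    (ha : 6 ≤ a) : NumberField.InfinitePlace.nrComplexPlaces K = 0 :=
  nrComplexPlaces_eq_zero_iff.mpr (isTotallyReal_of_csPoly hθ h3 ha)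

/-! ### The Minkowski bound for a totally real cubic field -/

/-- **`⌊M_K⌋ ≤ U` for a totally real cubic field**: if `r₂ = 0`, `|d_K| ≤ D ≤ s²` and
`(6/27) · s < U + 1`, then the Minkowski constant `M_K = (4/π)^{r₂} (3!/3³) √|d_K| = (2/9)√|d_K|`
has `⌊M_K⌋ ≤ U`. Marcus, *Number Fields*, Ch. 5, Cor. 2 of Thm. 37. [cite: Marcus2018, Ch. 5, Cor. 2 of Thm. 37] -/
theorem floor_minkowskiBound_le_cubic_real (h3 : finrank ℚ K = 3)
    (h0 : NumberField.InfinitePlace.nrComplexPlaces K = 0) {D : ℕ} {s : ℝ} {U : ℕ}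
    (hD : ((|NumberField.discr K| : ℤ) : ℝ) ≤ D) (hs : (D : ℝ) ≤ s ^ 2) (hs0 : 0 ≤ s)
    (hU : 6 / (3 : ℝ) ^ 3 * s < U + 1) :
    ⌊(4 / Real.pi) ^ NumberField.InfinitePlace.nrComplexPlaces K *
        ((finrank ℚ K).factorial / (finrank ℚ K : ℝ) ^ finrank ℚ K *
          Real.sqrt |(NumberField.discr K : ℝ)|)⌋₊ ≤ U := by
  have hD' : |(NumberField.discr K : ℝ)| ≤ D := by
    rw [← Int.cast_abs]
    exact hD
  have hsqrt : Real.sqrt |(NumberField.discr K : ℝ)| ≤ s := by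
    rw [Real.sqrt_le_iff]
    exact ⟨hs0, hD'.trans hs⟩
  rw [h3, h0, pow_zero, one_mul]
  have hfac : ((3 : ℕ).factorial : ℝ) = 6 := by norm_num [Nat.factorial]
  rw [hfac]
  refine Nat.le_of_lt_succ ((Nat.floor_lt (by positivity)).mpr ?_)
  push_cast
  calc 6 / (3 : ℝ) ^ 3 * Real.sqrt |(NumberField.discr K : ℝ)|
      ≤ 6 / (3 : ℝ) ^ 3 * s := by gcongr
    _ < (U : ℝ) + 1 := hU

end Field

end Literature.Topology.FourManifolds
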